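import Summits.QuantumFields.YangMills.Theorems.UnitScaleTiltProp7LatticeScaleTelescoping
import Mathlib.Analysis.InnerProductSpace.PiL2
import HarnessLib

/-!
# (n3)-COMB (II) «COMB = STRAIGHT ∘ BLOCK-AXIAL», row `hMcomb₂` — located difficulty H2-1, THE DEVICE in the CHAIN letters of file II-3:
# THE d = 3 LOCALISED-MASS (HARDY-TYPE) ROW ON NESTED CORNERED BLOCKS `D_j ⊆ D_{j+1} ⊆ ⋯ ⊆ D_k`

Crux `stmt-QuantumFields-19200` `MinimiserStabilityRegPr`, route-R E′ (A′)-on-Σ, package P-A2, row (β); supplier design (II) (★routeR-w1 g9 MASTER `DESIGN-N3COMB-LINEAR-CORE`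
6efb31c3 §4: `hMcomb₂`, LOCATED DIFFICULTY H2-1 and its DEVICE «cell mean + scale-telescoped oscillation (volume-free, d = 3)»; ★routeR-w6 g8 VERDICT (g3)).  Width seat
`ym3-torus-px18` (gen 4); `--kind proof --supports stmt-QuantumFields-19200 --as helper`; THEOREMS ONLY (0 `def`, 0 `sorry`); «(O2) groundwork — not consumed by any
displayed row before the freeze lifts»; count-neutral.  YM₃ on T³ is a ladder rung (R3), not Clay; nothing here is progress on the YM mass gap.

## The point
The `ℓ¹` propagation of the nonlinear remainders through the `Λ`-sector of the cornered comb propagator only SAMPLES the field near the level-`l` CORNERS (MASTER §4).  Its supplier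
therefore needs: the mass of a lattice field inside the SMALL cornered block `D_j` is at most the VOLUME FRACTION `|D_j|∕|D_k|` of its mass in the big block `D_k` plus a gradient
term whose coefficient is `(side D_j)² = (s₀Lʲ)²` — NOT `(side D_k)²`, and with NO dependence on the number of scales `k − j` («volume-free»; a Hardy-type inequality, true in
`d = 3`, logarithmically false in `d = 2`).  It is a COROLLARY of file II-3 (✓ `Prop7LatticeScaleTelescoping`, ★routeR-w6 g8): Poincaré with the mean on `D_j`
(`sum_sq_sub_avg_le_grad`), the scale chain for the means (`avg_sub_avg_sq_le_chain_top`, where `d = 3` makes the series geometric) multiplied back by `|D_j| = (s₀Lʲ)³`, and Jensen.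

## What is here (ns `…Theorems.Prop7LatticeLocalisedMassChain`; letters of II-3 §2: `D : ℕ → Finset (Fin 3 → ℤ)`, `x ∈ D i ↔ blockMap (nn i + 1) x = y i`, `(nn i) + 1 = s₀Lⁱ`)
* §1 (any index type) `card_mul_avg_sq_le` (Jensen `|B|·F̄_B² ≤ Σ_B F²`), `sum_sq_sub_eq_sum_sq_sub_avg_add` (`Σ_B(F − c)² = Σ_B(F − F̄_B)² + |B|(F̄_B − c)²`), `sq_le_weighted_split`
  (`F² ≤ (1+t⁻¹)(F − c)² + (1+t)c²`).
* §2 (`d = 3`) ★ `card_mul_avg_sub_avg_sq_le_chain` — `|D_j|·(F̄_{D_j} − F̄_{D_k})² ≤ (L²∕8)·c_L²·(s₀Lʲ)²·grad_{D_k}F` (`c_L = (1 − (√L)⁻¹)⁻¹`);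
  ★ `sum_sq_sub_topAvg_le_chain` — `Σ_{D_j}(F − F̄_{D_k})² ≤ (1∕8 + (L²∕8)c_L²)·(s₀Lʲ)²·grad_{D_k}F`.
* §3 (`d = 3`) ★★ `sum_sq_le_localisedMass_chain` — THE ROW: for `j ≤ k` and every `t > 0`,
  `Σ_{x∈D_j} F x² ≤ (1+t)·(|D_j|∕|D_k|)·Σ_{x∈D_k} F x² + (1+t⁻¹)·(1∕8 + (L²∕8)c_L²)·(s₀Lʲ)²·grad_{D_k}F`.
* §4 (`d = 3`) ★★ `sum_normSq_le_localisedMass_chain` — the same row, SAME constants, for `Y : (Fin 3 → ℤ) → V`, `V` any finite-dimensional real inner-product space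
  (orthonormal coordinates; every term is a sum of squares of coordinates), gradient energy `Σ_μ Σ_{x, x+e_μ ∈ D_k} ‖Y x − Y(x+e_μ)‖²`.
DEPENDENCE (VERDICT (g2)): the constant `1∕8 + (L²∕8)·c_L²` is a closed numeral in `L`; NOTHING depends on `j`, `k`, the number of scales, the torus, `K`, `n`, the member, `ε₀`.
NOT HERE: the sum over the level-`l` corners of one period cell, the `ℓ¹` knit of H2-1, transports.  HONEST: folklore lattice analysis; nothing of H2-1's knit ∕ `hMcomb₂` ∕
`hMcomb` ∕ (β) ∕ `hD` ∕ the crux is proved or claimed; rung R3 (YM₃ on T³), NOT d = 4, NOT infinite volume, NOT Clay; YM gap NOT proved.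
References: M. Giaquinta, *Multiple integrals in the calculus of variations and nonlinear elliptic systems*, Princeton 1983 [Giaquinta1984] (Ch. III §1 pp.64–72);
T. Bałaban, CMP 89 (1983) 571–597 [Balaban1983RegularityDecay] ((2.27) p.580); CMP 96 (1984) 223–250 [Balaban1984PropagatorsII] ((1.9) p.226).
-/

set_option autoImplicit false

noncomputable section

open scoped BigOperators RealInnerProductSpace
open Finset

namespace Summit.QuantumFields.YangMills.Theorems.Prop7LatticeLocalisedMassChain

open Literature.MathematicalPhysics.QuantumFieldTheory.Balaban1983to89
open Literature.MathematicalPhysics.QuantumLattice (blockMap)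
open B7Prop1Explicit (e)
open Summit.QuantumFields.YangMills.Theorems.Prop7LatticeScaleTelescoping

/-! ## §1 Jensen, the mean identity and the weighted split (any index type) -/

section Any

variable {ι : Type*}

/-- Jensen: `|B|·F̄_B² ≤ Σ_B F²`, `F̄_B = |B|⁻¹Σ_B F`. [folklore] [cite: Giaquinta1984, Ch. III §1 p.70] -/
theorem card_mul_avg_sq_le (B : Finset ι) (F : ι → ℝ) :
    (B.card : ℝ) * ((B.card : ℝ)⁻¹ * ∑ z ∈ B, F z) ^ 2 ≤ ∑ z ∈ B, F z ^ 2 := by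
  rcases B.eq_empty_or_nonempty with hB | hB
  · rw [hB]; simp
  have hc : (0 : ℝ) < B.card := by exact_mod_cast hB.card_pos
  have hJ : (∑ z ∈ B, F z) ^ 2 ≤ (B.card : ℝ) * ∑ z ∈ B, F z ^ 2 := sq_sum_le_card_mul_sum_sq
  calc (B.card : ℝ) * ((B.card : ℝ)⁻¹ * ∑ z ∈ B, F z) ^ 2 = (∑ z ∈ B, F z) ^ 2 / (B.card : ℝ) := by field_simp
    _ ≤ ∑ z ∈ B, F z ^ 2 := by rw [div_le_iff₀ hc]; linarith

/-- `Σ_B (F − c)² = Σ_B (F − F̄_B)² + |B|·(F̄_B − c)²` for a non-empty `B` and every constant `c`. [folklore] [cite: Giaquinta1984, Ch. III §1 p.70] -/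
theorem sum_sq_sub_eq_sum_sq_sub_avg_add (B : Finset ι) (hB : B.Nonempty) (F : ι → ℝ) (c : ℝ) :
    ∑ x ∈ B, (F x - c) ^ 2 = ∑ x ∈ B, (F x - (B.card : ℝ)⁻¹ * ∑ z ∈ B, F z) ^ 2 + (B.card : ℝ) * ((B.card : ℝ)⁻¹ * ∑ z ∈ B, F z - c) ^ 2 := by
  set a : ℝ := (B.card : ℝ)⁻¹ * ∑ z ∈ B, F z with ha
  have hc : (0 : ℝ) < B.card := by exact_mod_cast hB.card_pos
  have h0 : ∑ x ∈ B, (F x - a) = 0 := by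
    rw [Finset.sum_sub_distrib, Finset.sum_const, nsmul_eq_mul, ha, ← mul_assoc, mul_inv_cancel₀ hc.ne', one_mul, sub_self]
  calc ∑ x ∈ B, (F x - c) ^ 2 = ∑ x ∈ B, ((F x - a) ^ 2 + 2 * (a - c) * (F x - a) + (a - c) ^ 2) := Finset.sum_congr rfl fun x _ => by ring
    _ = ∑ x ∈ B, (F x - a) ^ 2 + 2 * (a - c) * ∑ x ∈ B, (F x - a) + (B.card : ℝ) * (a - c) ^ 2 := by
        rw [Finset.sum_add_distrib, Finset.sum_add_distrib, Finset.sum_const, nsmul_eq_mul, ← Finset.mul_sum]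
    _ = ∑ x ∈ B, (F x - a) ^ 2 + (B.card : ℝ) * (a - c) ^ 2 := by rw [h0]; ring

/-- the weighted split `F² ≤ (1 + t⁻¹)·(F − c)² + (1 + t)·c²` (`t > 0`). [folklore] -/
theorem sq_le_weighted_split (F c : ℝ) {t : ℝ} (ht : 0 < t) : F ^ 2 ≤ (1 + t⁻¹) * (F - c) ^ 2 + (1 + t) * c ^ 2 := by
  have h := sq_nonneg ((F - c) - t * c)
  have e : ((1 + t⁻¹) * (F - c) ^ 2 + (1 + t) * c ^ 2) * t - F ^ 2 * t = ((F - c) - t * c) ^ 2 := by field_simp; ring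
  have hmul : F ^ 2 * t ≤ ((1 + t⁻¹) * (F - c) ^ 2 + (1 + t) * c ^ 2) * t := by linarith [h, e]
  exact le_of_mul_le_mul_right hmul ht

end Any

/-! ## §2 The mean drift, multiplied back by the volume of the small block (`d = 3`) -/

/-- ★ `|D_j|·(F̄_{D_j} − F̄_{D_k})² ≤ (L²∕8)·c_L²·(s₀Lʲ)²·grad_{D_k}F` — ✓ `avg_sub_avg_sq_le_chain_top` (`… ≤ (L²∕8)c_L²(s₀Lʲ)⁻¹·grad`) times `|D_j| = (s₀Lʲ)³` (`card_box`).
[folklore] [cite: Giaquinta1984, Ch. III §1 Thm 1.2 p.70; Balaban1983RegularityDecay, (2.27) p.580] -/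
theorem card_mul_avg_sub_avg_sq_le_chain (D : ℕ → Finset (Fin 3 → ℤ)) (nn : ℕ → ℕ) (y : ℕ → Fin 3 → ℤ)
    (hD : ∀ i x, x ∈ D i ↔ blockMap (nn i + 1) x = y i) {s₀ L : ℝ} (hs₀ : 0 < s₀) (hL : 1 < L) (hside : ∀ i, ((nn i : ℝ) + 1) = s₀ * L ^ i)
    (hnest : ∀ i, D i ⊆ D (i + 1)) (F : (Fin 3 → ℤ) → ℝ) {j k : ℕ} (hjk : j ≤ k) :
    ((D j).card : ℝ) * (((D j).card : ℝ)⁻¹ * ∑ z ∈ D j, F z - ((D k).card : ℝ)⁻¹ * ∑ z ∈ D k, F z) ^ 2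
      ≤ L ^ 2 / 8 * (1 - (Real.sqrt L)⁻¹)⁻¹ ^ 2 * (s₀ * L ^ j) ^ 2 * ∑ μ : Fin 3, ∑ x ∈ (D k).filter (fun x => x + e μ ∈ D k), (F x - F (x + e μ)) ^ 2 := by
  have h := avg_sub_avg_sq_le_chain_top D nn y hD hs₀ hL hside hnest F hjk
  have hL0 : 0 < L := zero_lt_one.trans hL
  have hsj : 0 < s₀ * L ^ j := by positivity
  have hcard : ((D j).card : ℝ) = (s₀ * L ^ j) ^ 3 := by
    rw [card_box (nn j) (y j) (D j) (hD j)]; push_cast; rw [hside j]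
  set G : ℝ := ∑ μ : Fin 3, ∑ x ∈ (D k).filter (fun x => x + e μ ∈ D k), (F x - F (x + e μ)) ^ 2 with hG
  have hG0 : 0 ≤ G := Finset.sum_nonneg fun _ _ => Finset.sum_nonneg fun _ _ => sq_nonneg _
  set Δ : ℝ := (((D j).card : ℝ)⁻¹ * ∑ z ∈ D j, F z - ((D k).card : ℝ)⁻¹ * ∑ z ∈ D k, F z) ^ 2 with hΔ
  have hΔ0 : 0 ≤ Δ := sq_nonneg _
  rw [hcard]
  calc (s₀ * L ^ j) ^ 3 * Δ ≤ (s₀ * L ^ j) ^ 3 * (L ^ 2 / 8 * (1 - (Real.sqrt L)⁻¹)⁻¹ ^ 2 * (s₀ * L ^ j)⁻¹ * G) :=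
        mul_le_mul_of_nonneg_left h (by positivity)
    _ = L ^ 2 / 8 * (1 - (Real.sqrt L)⁻¹)⁻¹ ^ 2 * (s₀ * L ^ j) ^ 2 * G := by field_simp

/-- ★ `Σ_{x∈D_j} (F x − F̄_{D_k})² ≤ (1∕8 + (L²∕8)·c_L²)·(s₀Lʲ)²·grad_{D_k}F` — the mean identity, Poincaré with the mean on `D_j` (✓ `sum_sq_sub_avg_le_grad`, side `s₀Lʲ`, energy
monotone to `D_k`) and the mean drift above. [folklore] [cite: Giaquinta1984, Ch. III §1 pp.65–72; Balaban1983RegularityDecay, (2.27) p.580] -/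
theorem sum_sq_sub_topAvg_le_chain (D : ℕ → Finset (Fin 3 → ℤ)) (nn : ℕ → ℕ) (y : ℕ → Fin 3 → ℤ)
    (hD : ∀ i x, x ∈ D i ↔ blockMap (nn i + 1) x = y i) {s₀ L : ℝ} (hs₀ : 0 < s₀) (hL : 1 < L) (hside : ∀ i, ((nn i : ℝ) + 1) = s₀ * L ^ i)
    (hnest : ∀ i, D i ⊆ D (i + 1)) (F : (Fin 3 → ℤ) → ℝ) {j k : ℕ} (hjk : j ≤ k) :
    ∑ x ∈ D j, (F x - ((D k).card : ℝ)⁻¹ * ∑ z ∈ D k, F z) ^ 2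
      ≤ (1 / 8 + L ^ 2 / 8 * (1 - (Real.sqrt L)⁻¹)⁻¹ ^ 2) * (s₀ * L ^ j) ^ 2 *
          ∑ μ : Fin 3, ∑ x ∈ (D k).filter (fun x => x + e μ ∈ D k), (F x - F (x + e μ)) ^ 2 := by
  have hne : (D j).Nonempty := box_nonempty (nn j) (y j) (D j) (hD j)
  rw [sum_sq_sub_eq_sum_sq_sub_avg_add (D j) hne F]
  have h1 := sum_sq_sub_avg_le_grad (nn j) (y j) (D j) (hD j) F
  have h2 := card_mul_avg_sub_avg_sq_le_chain D nn y hD hs₀ hL hside hnest F hjk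
  have hmono := grad_mono (nest_mono D hnest hjk) F
  rw [hside j] at h1
  set G : ℝ := ∑ μ : Fin 3, ∑ x ∈ (D k).filter (fun x => x + e μ ∈ D k), (F x - F (x + e μ)) ^ 2 with hG
  have hL0 : 0 < L := zero_lt_one.trans hL
  have hsj2 : 0 ≤ (s₀ * L ^ j) ^ 2 := sq_nonneg _
  have h1' : ∑ x ∈ D j, (F x - ((D j).card : ℝ)⁻¹ * ∑ z ∈ D j, F z) ^ 2 ≤ (s₀ * L ^ j) ^ 2 / 8 * G :=
    h1.trans (mul_le_mul_of_nonneg_left hmono (by positivity))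
  calc ∑ x ∈ D j, (F x - ((D j).card : ℝ)⁻¹ * ∑ z ∈ D j, F z) ^ 2 +
        ((D j).card : ℝ) * (((D j).card : ℝ)⁻¹ * ∑ z ∈ D j, F z - ((D k).card : ℝ)⁻¹ * ∑ z ∈ D k, F z) ^ 2
      ≤ (s₀ * L ^ j) ^ 2 / 8 * G + L ^ 2 / 8 * (1 - (Real.sqrt L)⁻¹)⁻¹ ^ 2 * (s₀ * L ^ j) ^ 2 * G := add_le_add h1' h2
    _ = (1 / 8 + L ^ 2 / 8 * (1 - (Real.sqrt L)⁻¹)⁻¹ ^ 2) * (s₀ * L ^ j) ^ 2 * G := by ring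

/-! ## §3 The localised-mass row (`d = 3`, real-valued) -/

/-- ★★ **THE d = 3 LOCALISED-MASS (HARDY-TYPE) ROW ON NESTED CORNERED BLOCKS**: under the hypotheses of ✓ `avg_sub_avg_sq_le_chain` (blocks `D_i` of sides `s₀Lⁱ`,
`D_i ⊆ D_{i+1}`, `1 < L`), for `j ≤ k` and every `t > 0`,
`Σ_{x∈D_j} F x² ≤ (1+t)·(|D_j|∕|D_k|)·Σ_{x∈D_k} F x² + (1+t⁻¹)·(1∕8 + (L²∕8)·c_L²)·(s₀Lʲ)²·grad_{D_k}F` — the mass in the small block is the VOLUME FRACTION of the mass in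
the big block plus a gradient term with the SMALL side squared; `k − j` enters nowhere (`d = 3`). [folklore]
[cite: Giaquinta1984, Ch. III §1 pp.65–72; Balaban1984PropagatorsII, (1.9) p.226; Balaban1983RegularityDecay, (2.27) p.580] -/
theorem sum_sq_le_localisedMass_chain (D : ℕ → Finset (Fin 3 → ℤ)) (nn : ℕ → ℕ) (y : ℕ → Fin 3 → ℤ)
    (hD : ∀ i x, x ∈ D i ↔ blockMap (nn i + 1) x = y i) {s₀ L : ℝ} (hs₀ : 0 < s₀) (hL : 1 < L) (hside : ∀ i, ((nn i : ℝ) + 1) = s₀ * L ^ i)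
    (hnest : ∀ i, D i ⊆ D (i + 1)) (F : (Fin 3 → ℤ) → ℝ) {j k : ℕ} (hjk : j ≤ k) {t : ℝ} (ht : 0 < t) :
    ∑ x ∈ D j, F x ^ 2 ≤
      (1 + t) * (((D j).card : ℝ) / ((D k).card : ℝ)) * ∑ x ∈ D k, F x ^ 2 +
        (1 + t⁻¹) * ((1 / 8 + L ^ 2 / 8 * (1 - (Real.sqrt L)⁻¹)⁻¹ ^ 2) * (s₀ * L ^ j) ^ 2) *
          ∑ μ : Fin 3, ∑ x ∈ (D k).filter (fun x => x + e μ ∈ D k), (F x - F (x + e μ)) ^ 2 := by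
  set m : ℝ := ((D k).card : ℝ)⁻¹ * ∑ z ∈ D k, F z with hm
  set G : ℝ := ∑ μ : Fin 3, ∑ x ∈ (D k).filter (fun x => x + e μ ∈ D k), (F x - F (x + e μ)) ^ 2 with hG
  have hcardk : (0 : ℝ) < ((D k).card : ℝ) := by exact_mod_cast (box_nonempty (nn k) (y k) (D k) (hD k)).card_pos
  -- pointwise weighted split, summed
  have hsum : ∑ x ∈ D j, F x ^ 2 ≤ (1 + t⁻¹) * ∑ x ∈ D j, (F x - m) ^ 2 + (1 + t) * (((D j).card : ℝ) * m ^ 2) := by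
    calc ∑ x ∈ D j, F x ^ 2 ≤ ∑ x ∈ D j, ((1 + t⁻¹) * (F x - m) ^ 2 + (1 + t) * m ^ 2) :=
          Finset.sum_le_sum fun x _ => sq_le_weighted_split (F x) m ht
      _ = (1 + t⁻¹) * ∑ x ∈ D j, (F x - m) ^ 2 + (1 + t) * (((D j).card : ℝ) * m ^ 2) := by
          rw [Finset.sum_add_distrib, Finset.mul_sum, Finset.sum_const, nsmul_eq_mul]; ring
  -- Jensen on the big block
  have hJ : ((D j).card : ℝ) * m ^ 2 ≤ (((D j).card : ℝ) / ((D k).card : ℝ)) * ∑ x ∈ D k, F x ^ 2 := by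
    have hJ0 : ((D k).card : ℝ) * m ^ 2 ≤ ∑ x ∈ D k, F x ^ 2 := card_mul_avg_sq_le (D k) F
    have : ((D j).card : ℝ) * m ^ 2 = (((D j).card : ℝ) / ((D k).card : ℝ)) * (((D k).card : ℝ) * m ^ 2) := by
      field_simp
    rw [this]
    exact mul_le_mul_of_nonneg_left hJ0 (by positivity)
  have hdev := sum_sq_sub_topAvg_le_chain D nn y hD hs₀ hL hside hnest F hjk
  have ht1 : (0 : ℝ) ≤ 1 + t⁻¹ := by positivity
  have ht2 : (0 : ℝ) ≤ 1 + t := by linarith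
  calc ∑ x ∈ D j, F x ^ 2 ≤ (1 + t⁻¹) * ∑ x ∈ D j, (F x - m) ^ 2 + (1 + t) * (((D j).card : ℝ) * m ^ 2) := hsum
    _ ≤ (1 + t⁻¹) * ((1 / 8 + L ^ 2 / 8 * (1 - (Real.sqrt L)⁻¹)⁻¹ ^ 2) * (s₀ * L ^ j) ^ 2 * G) +
          (1 + t) * ((((D j).card : ℝ) / ((D k).card : ℝ)) * ∑ x ∈ D k, F x ^ 2) :=
        add_le_add (mul_le_mul_of_nonneg_left hdev ht1) (mul_le_mul_of_nonneg_left hJ ht2)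
    _ = _ := by ring

/-! ## §4 The same row for fields valued in a finite-dimensional real inner-product space (`d = 3`) -/

section Vector

variable {V : Type*} [NormedAddCommGroup V] [InnerProductSpace ℝ V] [FiniteDimensional ℝ V]

/-- ★★ **THE LOCALISED-MASS ROW ON NESTED CORNERED BLOCKS FOR VECTOR-VALUED FIELDS** (`d = 3`; `V` a finite-dimensional real inner-product space; SAME constants):
`Σ_{x∈D_j} ‖Y x‖² ≤ (1+t)·(|D_j|∕|D_k|)·Σ_{x∈D_k} ‖Y x‖² + (1+t⁻¹)·(1∕8 + (L²∕8)·c_L²)·(s₀Lʲ)²·Σ_μ Σ_{x, x+e_μ ∈ D_k} ‖Y x − Y(x+e_μ)‖²` (apply the scalar row to every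
coordinate `x ↦ ⟪b_i, Y x⟫` in an orthonormal basis and add: each term is a sum of squares of coordinates). [folklore] [cite: Giaquinta1984, Ch. III §1 pp.65–72] -/
theorem sum_normSq_le_localisedMass_chain (D : ℕ → Finset (Fin 3 → ℤ)) (nn : ℕ → ℕ) (y : ℕ → Fin 3 → ℤ)
    (hD : ∀ i x, x ∈ D i ↔ blockMap (nn i + 1) x = y i) {s₀ L : ℝ} (hs₀ : 0 < s₀) (hL : 1 < L) (hside : ∀ i, ((nn i : ℝ) + 1) = s₀ * L ^ i)
    (hnest : ∀ i, D i ⊆ D (i + 1)) (Y : (Fin 3 → ℤ) → V) {j k : ℕ} (hjk : j ≤ k) {t : ℝ} (ht : 0 < t) :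
    ∑ x ∈ D j, ‖Y x‖ ^ 2 ≤
      (1 + t) * (((D j).card : ℝ) / ((D k).card : ℝ)) * ∑ x ∈ D k, ‖Y x‖ ^ 2 +
        (1 + t⁻¹) * ((1 / 8 + L ^ 2 / 8 * (1 - (Real.sqrt L)⁻¹)⁻¹ ^ 2) * (s₀ * L ^ j) ^ 2) *
          ∑ μ : Fin 3, ∑ x ∈ (D k).filter (fun x => x + e μ ∈ D k), ‖Y x - Y (x + e μ)‖ ^ 2 := by
  classical
  set b := stdOrthonormalBasis ℝ V with hb
  set A : ℝ := (1 + t) * (((D j).card : ℝ) / ((D k).card : ℝ)) with hA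
  set B : ℝ := (1 + t⁻¹) * ((1 / 8 + L ^ 2 / 8 * (1 - (Real.sqrt L)⁻¹)⁻¹ ^ 2) * (s₀ * L ^ j) ^ 2) with hB
  have hns : ∀ w : V, ‖w‖ ^ 2 = ∑ i, ⟪b i, w⟫ ^ 2 := fun w => (b.sum_sq_inner_right w).symm
  -- the scalar row, coordinate by coordinate
  have hcoord : ∀ i, ∑ x ∈ D j, ⟪b i, Y x⟫ ^ 2 ≤ A * ∑ x ∈ D k, ⟪b i, Y x⟫ ^ 2 +
      B * ∑ μ : Fin 3, ∑ x ∈ (D k).filter (fun x => x + e μ ∈ D k), (⟪b i, Y x⟫ - ⟪b i, Y (x + e μ)⟫) ^ 2 :=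
    fun i => sum_sq_le_localisedMass_chain D nn y hD hs₀ hL hside hnest (fun x => ⟪b i, Y x⟫) hjk ht
  have hsub : ∀ i (x : Fin 3 → ℤ) (μ : Fin 3), (⟪b i, Y x⟫ - ⟪b i, Y (x + e μ)⟫) ^ 2 = ⟪b i, Y x - Y (x + e μ)⟫ ^ 2 := by
    intro i x μ; rw [inner_sub_right]
  -- every term as a sum over coordinates
  have eL : ∑ x ∈ D j, ‖Y x‖ ^ 2 = ∑ i, ∑ x ∈ D j, ⟪b i, Y x⟫ ^ 2 := by
    rw [Finset.sum_comm]; exact Finset.sum_congr rfl fun x _ => hns (Y x)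
  have eM : ∑ x ∈ D k, ‖Y x‖ ^ 2 = ∑ i, ∑ x ∈ D k, ⟪b i, Y x⟫ ^ 2 := by
    rw [Finset.sum_comm]; exact Finset.sum_congr rfl fun x _ => hns (Y x)
  have eG : ∑ μ : Fin 3, ∑ x ∈ (D k).filter (fun x => x + e μ ∈ D k), ‖Y x - Y (x + e μ)‖ ^ 2 =
      ∑ i, ∑ μ : Fin 3, ∑ x ∈ (D k).filter (fun x => x + e μ ∈ D k), (⟪b i, Y x⟫ - ⟪b i, Y (x + e μ)⟫) ^ 2 := by
    have e1 : ∑ μ : Fin 3, ∑ x ∈ (D k).filter (fun x => x + e μ ∈ D k), ‖Y x - Y (x + e μ)‖ ^ 2 =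
        ∑ μ : Fin 3, ∑ x ∈ (D k).filter (fun x => x + e μ ∈ D k), ∑ i, ⟪b i, Y x - Y (x + e μ)⟫ ^ 2 :=
      Finset.sum_congr rfl fun μ _ => Finset.sum_congr rfl fun x _ => hns _
    have e2 : ∀ μ ∈ (Finset.univ : Finset (Fin 3)),
        ∑ x ∈ (D k).filter (fun x => x + e μ ∈ D k), ∑ i, ⟪b i, Y x - Y (x + e μ)⟫ ^ 2 =
          ∑ i, ∑ x ∈ (D k).filter (fun x => x + e μ ∈ D k), ⟪b i, Y x - Y (x + e μ)⟫ ^ 2 :=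
      fun μ _ => Finset.sum_comm
    rw [e1, Finset.sum_congr rfl e2, Finset.sum_comm]
    refine Finset.sum_congr rfl fun i _ => Finset.sum_congr rfl fun μ _ => Finset.sum_congr rfl fun x _ => ?_
    rw [hsub]
  rw [eL, eM, eG]
  calc ∑ i, ∑ x ∈ D j, ⟪b i, Y x⟫ ^ 2
      ≤ ∑ i, (A * ∑ x ∈ D k, ⟪b i, Y x⟫ ^ 2 +
          B * ∑ μ : Fin 3, ∑ x ∈ (D k).filter (fun x => x + e μ ∈ D k), (⟪b i, Y x⟫ - ⟪b i, Y (x + e μ)⟫) ^ 2) :=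
        Finset.sum_le_sum fun i _ => hcoord i
    _ = _ := by rw [Finset.sum_add_distrib, ← Finset.mul_sum, ← Finset.mul_sum]

end Vector

end Summit.QuantumFields.YangMills.Theorems.Prop7LatticeLocalisedMassChain

end
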